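import Literature.Probability.Percolation.FourArmGarban
import Literature.Probability.Percolation.CrossingChains
import HarnessLib

/-!
# Garban's multi-scale four-arm bound: proofs (first bricks)

Topic `Literature/Probability/Percolation`; companion ("Proofs") file of `FourArmGarban.lean`
(the named fact `Garban2011_fourArm_multiscale`: C. Garban, Appendix B of O. Schramm,
S. Smirnov, *On the scaling limits of planar percolation*, Ann. Probab. 39 (2011), Lemma B.1;
restated as J. van den Berg, P. Nolin, Progr. Probab. 77 (2020), Lemma 8). Proofs only: no
definition, no named fact.

Garban's proof (loc. cit., "Proof of Lemma B.1") rests on Kesten's separation of four alternating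
arms with fences for bond percolation on `ℤ²` (his (B.2) `P⁴(r,R) ≍ P[Q_j pivotal for X]` and the
conditional estimate `E[X | C_j = 1, Q_j pivotal] > 1/4`), a theory the tree does not have for the
square lattice; van den Berg–Nolin (2020, §5.1) record that they "do not see how to avoid that
result in the proof of Lemma 8 for a general `m ≥ 1`". This file proves the elementary,
separation-free part of the dictionary between the cluster-form events of `FourArmGarban.lean`:

* `exists_mem_support_inter_of_enclosesOrigin` — **an open circuit of the annulus
  `A_{m,n} = {m ≤ ‖·‖_∞ ≤ n}` surrounding the origin meets every lattice path of `A_{m,n}` from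
  `‖·‖_∞ = m` to `‖·‖_∞ = n`** (planar topology from the tree's `EnclosesOrigin`: the segment
  from the origin to the inner endpoint and the outward ray from the outer endpoint miss the
  trace of the circuit, traces of vertex-disjoint lattice walks are disjoint
  (`exists_mem_support_of_walkTrace_inter_nonempty`), and the component of the origin off the
  trace is bounded);
* `not_mem_openCircuitInAnnulus_of_mem_fourArmTwoClusters`,
  `real_fourArmTwoClusters_le_twoArmOpenDual` — hence two open crossings in distinct open
  clusters of the annulus exclude an open circuit around the origin, and **`π₄(m,n) ≤ π₂(m,n)`**
  for the events `fourArmTwoClusters ⊆ twoArmOpenDual` (on lattice configurations, i.e.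
  `P_{1/2}`-a.s.), the four-arm analogue of the tree's `twoArmOpenDual_subset_openCrossing`;
* `fourArm_multiscale_of_one_le` — the degenerate range `ε ≥ 1` of the fact, where the
  hypothesis `π₂(m,n) ≤ c'(m/n)^{2ε}` already dominates the conclusion (`2ε ≥ 1 + ε`,
  `m/n ≤ 1`); the content of Garban's lemma is the range `ε < 1` (indeed `ε ≤ α₂/2`), which is
  NOT proved here.

## References

* O. Schramm, S. Smirnov (appendix by C. Garban), *On the scaling limits of planar percolation*,
  Ann. Probab. 39 (2011) 1768–1814, Appendix B, Lemma B.1 [SchrammSmirnov2011].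
* J. van den Berg, P. Nolin, *On the four-arm exponent for 2D percolation at criticality*,
  In and Out of Equilibrium 3, Progr. Probab. 77 (2020), §4.3 Lemma 8, §5 [VandenbergNolin2020].
* H. Kesten, *Percolation theory for mathematicians* (1982), §2.2–2.3 (arm events vs. clusters
  on the self-dual square lattice) [KestenPTM1982].

Tree: `siteSphere`, `sqAnnulus`, `fourArmTwoClusters`, `twoArmOpenDual`, `openCircuitInAnnulus`,
`fourArmTwoClusters_subset_openCrossing` (`FourArmGarban.lean`), `EnclosesOrigin`, `walkTrace`,
`mem_walkTrace_iff` (`AnnulusCircuits.lean`), `coordVec`, `mem_edgeTrace_single_iff`,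
`mem_of_toComplex_mem_edgeTrace` (`LatticeTraceGeometry.lean`), `isPreconnected_walkTrace`,
`toComplex_start_mem_walkTrace`, `toComplex_end_mem_walkTrace`,
`exists_mem_support_of_walkTrace_inter_nonempty` (`CrossingChains.lean`),
`exists_walk_of_mem_openConnIn`, `mem_openConnIn_of_mem_support`, `openConnIn_comm`,
`PlanarDuality.openConnIn_trans` (`PlanarDuality.lean`),
`mem_edgeSet_zdGraph_iff` (`Crossings.lean`). Mathlib: `connectedComponentIn_eq`,
`IsPreconnected.subset_connectedComponentIn`, `segment_eq_image`, `isBounded_iff_forall_norm_le`,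
`ProbabilityTheory.setBernoulli_ae_subset`,
`Real.rpow_le_rpow_of_exponent_ge`.
-/

noncomputable section

namespace Literature.Probability.Percolation

open _root_.MeasureTheory Set Metric LatticeModels

/-! ### Coordinates on the sphere, the annulus and on traces of annulus edges -/

/-- Membership in the sup-norm sphere `‖x‖_∞ = m` (`m ≥ 1`), in coordinates. [folklore] -/
theorem mem_siteSphere_iff {m : ℕ} (hm : 1 ≤ m) {x : Site 2} :
    x ∈ siteSphere m ↔ (∀ i, -(m : ℤ) ≤ x i ∧ x i ≤ m) ∧ ∃ i, (m : ℤ) ≤ x i ∨ x i ≤ -(m : ℤ) := by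
  simp only [siteSphere, Finset.mem_sdiff, mem_box, not_forall, not_and_or, not_le]
  refine and_congr_right fun _ => exists_congr fun i => ?_
  omega

/-- The sphere `‖x‖_∞ = m` is empty for `m = 0` in the tree's rendering (`box 0 ∖ box 0`), so a
member forces `1 ≤ m`. [folklore] -/
theorem one_le_of_mem_siteSphere {m : ℕ} {x : Site 2} (hx : x ∈ siteSphere m) : 1 ≤ m := by
  rcases Nat.eq_zero_or_pos m with rfl | h
  · simp [siteSphere] at hx
  · exact h

/-- Membership in the square annulus `A_{m,n} = {m ≤ ‖x‖_∞ ≤ n}` (`m ≥ 1`), in coordinates.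
[folklore] -/
theorem mem_sqAnnulus_iff {m n : ℕ} (hm : 1 ≤ m) {x : Site 2} :
    x ∈ sqAnnulus m n ↔ (∀ i, -(n : ℤ) ≤ x i ∧ x i ≤ n) ∧ ∃ i, (m : ℤ) ≤ x i ∨ x i ≤ -(m : ℤ) := by
  simp only [sqAnnulus, Finset.mem_coe, mem_annulus, mem_box, not_forall, not_and_or, not_le]
  refine and_congr_right fun _ => exists_congr fun i => ?_
  omega

/-- The absolute value of a coordinate is at most the norm. [folklore] -/
theorem abs_coordVec_le_norm (z : ℂ) (k : Fin 2) : |coordVec z k| ≤ ‖z‖ := by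
  fin_cases k
  · simpa using Complex.abs_re_le_norm z
  · simpa using Complex.abs_im_le_norm z

/-- **Traces of annulus edges stay in the closed planar annulus.** A point on the trace of an
edge of `ℤ²` with both endpoints in `A_{m,n}` has all coordinates in `[-n, n]` and some
coordinate of absolute value at least `m`. [folklore] -/
theorem coordVec_bounds_of_mem_edgeTrace {m n : ℕ} (hm : 1 ≤ m) {e : Sym2 (Site 2)}
    (he : e ∈ (zdGraph 2).edgeSet) (hS : ∀ x ∈ e, x ∈ sqAnnulus m n) {z : ℂ}
    (hz : z ∈ edgeTrace e) :
    (∀ k, -(n : ℝ) ≤ coordVec z k ∧ coordVec z k ≤ n) ∧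
      ∃ k, (m : ℝ) ≤ coordVec z k ∨ coordVec z k ≤ -(m : ℝ) := by
  obtain ⟨u, i, rfl⟩ := mem_edgeSet_zdGraph_iff.1 he
  have hu := (mem_sqAnnulus_iff hm).1 (hS u (Sym2.mem_mk_left _ _))
  have hu' := (mem_sqAnnulus_iff hm).1 (hS (u + Pi.single i 1) (Sym2.mem_mk_right _ _))
  obtain ⟨hoff, h1, h2⟩ := mem_edgeTrace_single_iff.1 hz
  have hsame : (u + Pi.single i (1 : ℤ) : Site 2) i = u i + 1 := by simp
  have hother : ∀ k, k ≠ i → (u + Pi.single i (1 : ℤ) : Site 2) k = u k := fun k hk => by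
    rw [Pi.add_apply, Pi.single_apply, if_neg hk, add_zero]
  -- coordinates off `i` are those of `u`
  have hoffk : ∀ k, k ≠ i → coordVec z k = u k := hoff
  refine ⟨fun k => ?_, ?_⟩
  · by_cases hk : k = i
    · subst hk
      have hb := hu.1 k
      have hb' := hu'.1 k
      rw [hsame] at hb'
      have h3 : (-(n : ℤ) : ℝ) ≤ (u k : ℝ) := by exact_mod_cast hb.1
      have h4 : ((u k + 1 : ℤ) : ℝ) ≤ (n : ℝ) := by exact_mod_cast hb'.2
      push_cast at h3 h4
      exact ⟨by linarith, by linarith⟩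
    · rw [hoffk k hk]
      have hb := hu.1 k
      exact ⟨by exact_mod_cast hb.1, by exact_mod_cast hb.2⟩
  · obtain ⟨k, hk⟩ := hu.2
    by_cases hki : k = i
    · subst hki
      obtain ⟨k', hk'⟩ := hu'.2
      by_cases hk'i : k' = k
      · subst hk'i
        rw [hsame] at hk'
        refine ⟨k', ?_⟩
        rcases hk with hk | hk
        · left
          have : ((m : ℤ) : ℝ) ≤ (u k' : ℝ) := by exact_mod_cast hk
          push_cast at this
          linarith
        · right
          have hk'' : u k' + 1 ≤ -(m : ℤ) := by omega
          have : ((u k' + 1 : ℤ) : ℝ) ≤ ((-(m : ℤ) : ℤ) : ℝ) := by exact_mod_cast hk''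
          push_cast at this
          linarith
      · refine ⟨k', ?_⟩
        rw [hoffk k' hk'i]
        rw [hother k' hk'i] at hk'
        rcases hk' with hk' | hk'
        · left; exact_mod_cast hk'
        · right; exact_mod_cast hk'
    · refine ⟨k, ?_⟩
      rw [hoffk k hki]
      rcases hk with hk | hk
      · left; exact_mod_cast hk
      · right; exact_mod_cast hk

/-! ### An enclosing open circuit of the annulus meets every crossing path -/

/-- **An enclosing circuit of `A_{m,n}` meets every crossing of `A_{m,n}`.** If a walk `c` of
`ℤ²` with all vertices in the annulus `A_{m,n} = {m ≤ ‖·‖_∞ ≤ n}` encloses the origin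
(`EnclosesOrigin`), then every walk of `ℤ²` inside `A_{m,n}` from a site with `‖x‖_∞ = m` to a
site with `‖y‖_∞ = n` has a vertex in common with `c`. (The discrete Jordan-curve fact behind
"an open circuit in the annulus prevents a closed dual crossing, and meets every open crossing";
Kesten 1982, §2.2–2.3; Grimmett 1999, §11.7.) [folklore] -/
theorem exists_mem_support_inter_of_enclosesOrigin {m n : ℕ} (hm : 1 ≤ m)
    {u : Site 2} {c : (zdGraph 2).Walk u u}
    (hcs : ∀ z ∈ c.support, z ∈ sqAnnulus m n) (hce : EnclosesOrigin c)
    {x y : Site 2} (hx : x ∈ siteSphere m) (hy : y ∈ siteSphere n)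
    (p : (zdGraph 2).Walk x y) (hps : ∀ z ∈ p.support, z ∈ sqAnnulus m n) :
    ∃ z, z ∈ p.support ∧ z ∈ c.support := by
  by_contra hcon
  simp only [not_exists, not_and] at hcon
  have hn : 1 ≤ n := one_le_of_mem_siteSphere hy
  -- every point of the trace of `c` has all coordinates in `[-n, n]` and one of size `≥ m`
  have htr : ∀ z ∈ walkTrace c, (∀ k, -(n : ℝ) ≤ coordVec z k ∧ coordVec z k ≤ n) ∧
      ∃ k, (m : ℝ) ≤ coordVec z k ∨ coordVec z k ≤ -(m : ℝ) := by
    intro z hz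
    obtain ⟨e, he, hze⟩ := mem_walkTrace_iff.1 hz
    exact coordVec_bounds_of_mem_edgeTrace hm (c.edges_subset_edgeSet he)
      (fun w hw => hcs w (c.mem_support_of_mem_edges he hw)) hze
  -- lattice points on the trace of `c` are vertices of `c`
  have hvert : ∀ w : Site 2, Site.toComplex w ∈ walkTrace c → w ∈ c.support := by
    intro w hw
    obtain ⟨e, he, hwe⟩ := mem_walkTrace_iff.1 hw
    exact c.mem_support_of_mem_edges he
      (mem_of_toComplex_mem_edgeTrace (c.edges_subset_edgeSet he) hwe)
  set U : Set ℂ := connectedComponentIn (walkTrace c)ᶜ (0 : ℂ) with hU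
  have hXt : Site.toComplex x ∉ walkTrace c := fun h => hcon x p.start_mem_support (hvert x h)
  have hYt : Site.toComplex y ∉ walkTrace c := fun h => hcon y p.end_mem_support (hvert y h)
  have hm0 : (0 : ℝ) < m := by exact_mod_cast hm
  -- (A) the inner endpoint is enclosed: the segment `[0, x]` misses the trace
  have hXU : Site.toComplex x ∈ U := by
    have hseg : segment ℝ (0 : ℂ) (Site.toComplex x) ⊆ (walkTrace c)ᶜ := by
      intro z hz hzt
      rw [segment_eq_image] at hz
      obtain ⟨θ, ⟨hθ0, hθ1⟩, rfl⟩ := hz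
      rcases eq_or_lt_of_le hθ1 with rfl | hθ1'
      · exact hXt (by simpa using hzt)
      · obtain ⟨-, k, hk⟩ := htr _ hzt
        have hxk : -(m : ℤ) ≤ x k ∧ x k ≤ m := ((mem_siteSphere_iff hm).1 hx).1 k
        have hxk' : -(m : ℝ) ≤ (x k : ℝ) ∧ (x k : ℝ) ≤ m := by exact_mod_cast hxk
        have hcoord : coordVec ((1 - θ) • (0 : ℂ) + θ • Site.toComplex x) k = θ * x k := by
          rw [smul_zero, zero_add, coordVec_smul, coordVec_toComplex]
        rw [hcoord] at hk
        rcases hk with hk | hk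
        · nlinarith [mul_nonneg hθ0 (sub_nonneg.2 hxk'.2), mul_pos (sub_pos.2 hθ1') hm0]
        · nlinarith [mul_nonneg hθ0 (neg_nonneg.2 (sub_nonpos.2 hxk'.1)),
            mul_pos (sub_pos.2 hθ1') hm0]
    exact (convex_segment (0 : ℂ) (Site.toComplex x)).isPreconnected.subset_connectedComponentIn
      (left_mem_segment ℝ _ _) hseg (right_mem_segment ℝ _ _)
  -- (B) the outer endpoint is not enclosed: the outward ray misses the trace and is unbounded
  have hYU : Site.toComplex y ∉ U := by
    intro hYU
    obtain ⟨hyb, i, hi⟩ := (mem_siteSphere_iff hn).1 hy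
    obtain ⟨s, hs1, hsy⟩ : ∃ s : ℤ, (s = 1 ∨ s = -1) ∧ s * y i = n := by
      rcases hi with hi | hi
      · exact ⟨1, Or.inl rfl, by have := (hyb i).2; omega⟩
      · exact ⟨-1, Or.inr rfl, by have := (hyb i).1; omega⟩
    set D : ℂ := Site.toComplex (Pi.single i s) with hD
    set R : Set ℂ := (fun t : ℝ => Site.toComplex y + t • D) '' Ici 0 with hR
    have hcoordR : ∀ t : ℝ, (s : ℝ) * coordVec (Site.toComplex y + t • D) i = n + t := by
      intro t
      rw [coordVec_add, coordVec_smul, coordVec_toComplex, hD, coordVec_toComplex]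
      have hsy' : (s : ℝ) * (y i : ℝ) = n := by exact_mod_cast hsy
      have hss : (s : ℝ) * s = 1 := by rcases hs1 with rfl | rfl <;> norm_num
      simp only [Pi.single_eq_same]
      linear_combination hsy' + t * hss
    have hRsub : R ⊆ (walkTrace c)ᶜ := by
      rintro _ ⟨t, ht, rfl⟩ hzt
      rw [mem_Ici] at ht
      rcases eq_or_lt_of_le ht with rfl | htpos
      · exact hYt (by simpa using hzt)
      · obtain ⟨hub, -⟩ := htr _ hzt
        have hb := hub i
        have hkey := hcoordR t
        rcases hs1 with rfl | rfl
        · push_cast at hkey; linarith [hb.2]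
        · push_cast at hkey; linarith [hb.1]
    have hRconn : IsPreconnected R := isPreconnected_Ici.image _ (by fun_prop)
    have hYR : Site.toComplex y ∈ R := ⟨0, mem_Ici.2 le_rfl, by simp⟩
    have hRU : R ⊆ U := by
      have := hRconn.subset_connectedComponentIn hYR hRsub
      rwa [← connectedComponentIn_eq hYU] at this
    obtain ⟨C, hC⟩ := isBounded_iff_forall_norm_le.1 (hce.2.subset hRU)
    set t : ℝ := |C| + 1 with ht
    have htR : Site.toComplex y + t • D ∈ R := ⟨t, mem_Ici.2 (by positivity), rfl⟩
    have h1 : (n : ℝ) + t ≤ ‖Site.toComplex y + t • D‖ := by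
      have hle := abs_coordVec_le_norm (Site.toComplex y + t • D) i
      have hkey := hcoordR t
      have habs : |(s : ℝ) * coordVec (Site.toComplex y + t • D) i| =
          |coordVec (Site.toComplex y + t • D) i| := by
        rw [abs_mul]
        rcases hs1 with rfl | rfl <;> simp
      rw [← habs, hkey] at hle
      have hnt : 0 ≤ (n : ℝ) + t := by positivity
      rwa [abs_of_nonneg hnt] at hle
    have h2 := hC _ htR
    have h3 : C < t := by rw [ht]; linarith [le_abs_self C]
    have h4 : (0 : ℝ) ≤ n := by positivity
    linarith
  -- (C) the trace of `p` joins the two endpoints off the trace of `c`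
  by_cases hp : p.Nil
  · cases hp
    exact hYU hXU
  · have hpt : walkTrace p ⊆ (walkTrace c)ᶜ := by
      intro z hz hzc
      obtain ⟨w, hw, hwc⟩ := exists_mem_support_of_walkTrace_inter_nonempty ⟨z, hz, hzc⟩
      exact hcon w hw hwc
    have hsub : walkTrace p ⊆ U := by
      have := (isPreconnected_walkTrace p).subset_connectedComponentIn
        (toComplex_start_mem_walkTrace hp) hpt
      rwa [← connectedComponentIn_eq hXU] at this
    exact hYU (hsub (toComplex_end_mem_walkTrace hp))

/-! ### `π₄ ≤ π₂`: two crossing clusters exclude an open circuit around the origin -/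

/-- **Four arms exclude an open circuit around the origin.** On a lattice configuration, if the
annulus `A_{m,n}` contains two open crossings whose inner endpoints are not joined by an open path
of the annulus (`fourArmTwoClusters`), then no open circuit of the annulus surrounds the origin:
such a circuit would meet both crossings (`exists_mem_support_inter_of_enclosesOrigin`) and join
them. (Kesten 1982, §2.2–2.3; the "four arms ⇒ two arms" half of the arm-event dictionary.)
[folklore] -/
theorem not_mem_openCircuitInAnnulus_of_mem_fourArmTwoClusters {m n : ℕ} (hm : 1 ≤ m)
    {ω : BondConfig (Site 2)} (hω : ω ⊆ (zdGraph 2).edgeSet) (h4 : ω ∈ fourArmTwoClusters m n) :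
    ω ∉ openCircuitInAnnulus m n := by
  rintro ⟨u, c, -, hcs, hco, hce⟩
  obtain ⟨x₁, hx₁, x₂, hx₂, y₁, hy₁, y₂, hy₂, h₁, h₂, h₁₂⟩ := h4
  obtain ⟨p₁, hp₁s, hp₁o⟩ := exists_walk_of_mem_openConnIn hω h₁
  obtain ⟨p₂, hp₂s, hp₂o⟩ := exists_walk_of_mem_openConnIn hω h₂
  obtain ⟨z₁, hz₁p, hz₁c⟩ := exists_mem_support_inter_of_enclosesOrigin hm hcs hce hx₁ hy₁ p₁ hp₁s
  obtain ⟨z₂, hz₂p, hz₂c⟩ := exists_mem_support_inter_of_enclosesOrigin hm hcs hce hx₂ hy₂ p₂ hp₂s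
  have e₁ : ω ∈ openConnIn (sqAnnulus m n) x₁ z₁ := mem_openConnIn_of_mem_support p₁ hp₁s hp₁o hz₁p
  have e₂ : ω ∈ openConnIn (sqAnnulus m n) x₂ z₂ := mem_openConnIn_of_mem_support p₂ hp₂s hp₂o hz₂p
  have f₁ : ω ∈ openConnIn (sqAnnulus m n) u z₁ := mem_openConnIn_of_mem_support c hcs hco hz₁c
  have f₂ : ω ∈ openConnIn (sqAnnulus m n) u z₂ := mem_openConnIn_of_mem_support c hcs hco hz₂c
  rw [openConnIn_comm] at f₁ e₂
  exact h₁₂ (PlanarDuality.openConnIn_trans (PlanarDuality.openConnIn_trans e₁ f₁)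
    (PlanarDuality.openConnIn_trans f₂ e₂))

/-- On lattice configurations the four-arm event is contained in the two-arm event
(`fourArmTwoClusters ⊆ twoArmOpenDual`). [folklore] -/
theorem mem_twoArmOpenDual_of_mem_fourArmTwoClusters {m n : ℕ} (hm : 1 ≤ m)
    {ω : BondConfig (Site 2)} (hω : ω ⊆ (zdGraph 2).edgeSet) (h4 : ω ∈ fourArmTwoClusters m n) :
    ω ∈ twoArmOpenDual m n :=
  ⟨fourArmTwoClusters_subset_openCrossing m n h4,
    not_mem_openCircuitInAnnulus_of_mem_fourArmTwoClusters hm hω h4⟩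

/-- **`π₄(m,n) ≤ π₂(m,n)`** at `p = 1/2` for the cluster-form events of `FourArmGarban.lean`
(lattice configurations carry `P_{1/2}`, `ae_subset_edgeSet`). (van den Berg–Nolin 2020, §2:
monotonicity of arm events in the number of arms.) [folklore] -/
theorem real_fourArmTwoClusters_le_twoArmOpenDual {m : ℕ} (hm : 1 ≤ m) (n : ℕ) :
    (bondPercolation (zdGraph 2) half).real (fourArmTwoClusters m n) ≤
      (bondPercolation (zdGraph 2) half).real (twoArmOpenDual m n) := by
  refine ENNReal.toReal_mono (measure_ne_top _ _) (measure_mono_ae ?_)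
  have hae : ∀ᵐ ω ∂(bondPercolation (zdGraph 2) half), ω ⊆ (zdGraph 2).edgeSet :=
    ProbabilityTheory.setBernoulli_ae_subset
  filter_upwards [hae] with ω hω h4
  exact mem_twoArmOpenDual_of_mem_fourArmTwoClusters hm hω h4

/-! ### The degenerate range `ε ≥ 1` of Garban's bound -/

/-- **Garban's multi-scale bound in the degenerate range `ε ≥ 1`.** If `ε ≥ 1` and
`π₂(m,n) ≤ c'(m/n)^{2ε}` for all `1 ≤ m ≤ n`, then `π₄(m,n) ≤ c'(m/n)^{1+ε}` for all
`1 ≤ m ≤ n`, simply because `π₄ ≤ π₂` and `(m/n)^{2ε} ≤ (m/n)^{1+ε}` for `m/n ≤ 1`,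
`2ε ≥ 1 + ε`. This range is vacuous in substance (the two-arm hypothesis can only hold for
`ε ≤ α₂/2 ≤ 1/2`); the content of `Garban2011_fourArm_multiscale` is the range `ε < 1`, which
needs Garban's argument (Schramm–Smirnov 2011, App. B) and is not proved here. [cite: SchrammSmirnov2011, Appendix B, Lemma B.1 (degenerate range only)] -/
theorem fourArm_multiscale_of_one_le {ε : ℝ} (hε : 1 ≤ ε)
    (h₂ : ∃ c' : ℝ, 0 < c' ∧ ∀ m n : ℕ, 1 ≤ m → m ≤ n →
      (bondPercolation (zdGraph 2) half).real (twoArmOpenDual m n) ≤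
        c' * ((m : ℝ) / n) ^ (2 * ε)) :
    ∃ c : ℝ, 0 < c ∧ ∀ m n : ℕ, 1 ≤ m → m ≤ n →
      (bondPercolation (zdGraph 2) half).real (fourArmTwoClusters m n) ≤
        c * ((m : ℝ) / n) ^ (1 + ε) := by
  obtain ⟨c', hc', h⟩ := h₂
  refine ⟨c', hc', fun m n hm hmn => ?_⟩
  have hm0 : (0 : ℝ) < m := by exact_mod_cast hm
  have hn0 : (0 : ℝ) < n := by exact_mod_cast (hm.trans hmn)
  have hq0 : 0 < (m : ℝ) / n := div_pos hm0 hn0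
  have hq1 : (m : ℝ) / n ≤ 1 := (div_le_one hn0).2 (by exact_mod_cast hmn)
  calc (bondPercolation (zdGraph 2) half).real (fourArmTwoClusters m n)
      ≤ (bondPercolation (zdGraph 2) half).real (twoArmOpenDual m n) :=
        real_fourArmTwoClusters_le_twoArmOpenDual hm n
    _ ≤ c' * ((m : ℝ) / n) ^ (2 * ε) := h m n hm hmn
    _ ≤ c' * ((m : ℝ) / n) ^ (1 + ε) :=
        mul_le_mul_of_nonneg_left (Real.rpow_le_rpow_of_exponent_ge hq0 hq1 (by linarith)) hc'.le

end Literature.Probability.Percolation
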